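import Summits.MatrixMultiplication.OmegaCensus.STPPKernelListerOrderN53Y
import Literature.Combinatorics.Additive.TightTriangleRemovalProofs

/-!
# ω-census (abelian STPP census): order `53`, `H`-generic — no beating STPP family in any abelian group of order `53` MODULO `{(3,3,3),(3,3,3)} ⊄ ℤ₅₃` (kernel)

HONEST FRAMING (pub-omega census; verbatim): lottery ticket; floor = certified bounds/negative ranges.
Census STRUCTURE (seat pub-omega-stpp-2 gen 31, 2026-08-29), family (b2).  Transport of `CubeNB.volume_le_card_zmod53_of_not_realizable_333_333`
(`…OrderN53Y.lean`) along `addEquivOfPrimeCardEq` + `IsSTPP.image` (as `…OrderN47H.lean` for order `47`): for EVERY finite abelian group `H` of order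
`53` and every STPP family of `H`, `Σ |Aᵢ||Bᵢ||Cᵢ| ≤ 53` PROVIDED the size pattern `{(3,3,3),(3,3,3)}` has no STPP realisation in `ℤ/53` (the one
tree-law survivor left at order 53; slack 4).  Order `53` thus joins the `H`-generic series in its conditional form with a single named hypothesis.
Nothing here is progress on `ω`.
-/

open Finset

namespace Summit.MatrixMultiplication.OmegaCensus.KLister

open Literature.Computability.AlgebraicComplexity

/-- **Order 53, `H`-generic, modulo `333_333 ⊄ ℤ₅₃`.** [cite: CohnKleinbergSzegedyUmans2005, Def. 5.1] -/
theorem volume_le_of_card_eq_53_of_not_realizable_333_333 {H : Type*} [AddCommGroup H] [Fintype H] [DecidableEq H] (hH : Fintype.card H = 53)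
    (h333 : ¬ Realizable (ZMod 53) ([(3, 3, 3), (3, 3, 3)] : List Shape))
    {m : ℕ} (A B C : Fin m → Finset H) (hS : IsSTPP A B C) : ∑ i, #(A i) * #(B i) * #(C i) ≤ 53 := by
  haveI : Fact (Nat.Prime 53) := ⟨by norm_num⟩
  have h1 : Nat.card H = 53 := by rw [Nat.card_eq_fintype_card, hH]
  have h2 : Nat.card (ZMod 53) = 53 := Nat.card_zmod 53
  let e : H ≃+ ZMod 53 := addEquivOfPrimeCardEq h1 h2
  have hS' : IsSTPP (fun i => (A i).image e) (fun i => (B i).image e) (fun i => (C i).image e) := hS.image e e.injective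
  have h := CubeNB.volume_le_card_zmod53_of_not_realizable_333_333 h333 _ _ _ hS'
  simp only [card_image_of_injective _ e.injective] at h
  exact h

end Summit.MatrixMultiplication.OmegaCensus.KLister
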